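import Literature.Barriers.Parity.SmallScalePatternsEndgame
import Literature.Barriers.Parity.EquidistributionLimitsMaierProofs
import HarnessLib

/-!
# Small-scale irregularity of linear patterns of primes: the case of one form, PROVED

Proof companion (part 4 of 4) of `Literature/Barriers/Parity/SmallScalePatterns.lean`
(Pandey–Woo 2024, Theorem 5 = the named fact `SmallScalePatternIrregularity`). Everything here is
PROVED. Main results:

* `smallScalePatternIrregularity_fin_one` — the conclusion of `SmallScalePatternIrregularity` for
  every in-scope system consisting of ONE form (`t = 1`, any `d ≥ 1`): for every `λ > 1` there are
  `δ± > 0` such that for arbitrarily large `X`, `H = (log X)^λ`, some box `∏ⱼ[xⱼ, xⱼ + H]` with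
  corner in `[X, 2X]^d` contains `≥ (1 + δ⁺) H^d (log X)^{-1} ∏_p β_p` points `n` with `ψ(n)`
  prime and another contains `≤ (1 − δ⁻) H^d (log X)^{-1} ∏_p β_p` of them;
* `smallScalePatternIrregularity_dim_one` — the case `d = 1` of the fact for all `t ≥ 1` (in
  dimension one an in-scope system has a single form `ψ(n) = a n`; `a = 1` is Maier's theorem for
  all `λ > 1` — the paper's Theorem 1 — in the box normalisation of Theorem 5);
* `not_smallScaleUniformity_fin_one` — hence the Cramér-type small-scale uniformity
  `SmallScaleUniformity Ψ λ` fails for every primitive single form and every `λ > 1`.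

The general case (`t ≥ 2` forms coupling several coordinates, e.g. `(x, x+y, x+2y, x+3y)`) is
Pandey–Woo's theorem proper and rests on the Green–Tao–Ziegler machinery in progressions
(their Proposition 7) and Matthiesen's theorem (Proposition 8); it is NOT proved here and the
named fact `SmallScalePatternIrregularity` stays a `def`.

## Proof (case `t = 1`)

Write `ψ(n) = ∑ⱼ cⱼ nⱼ`, `cⱼ ≥ 0`, `c ≠ 0`, `c₀ = ∑ⱼ cⱼ`. If a prime `p` divides every `cⱼ`
then `β_p = 0`, `∏_p β_p = 0` and no `ψ(n)`, `n ∈ [X, 2X]^d`, `X ≥ 2`, is prime: both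
inequalities are trivial. Otherwise (`SingleForm.bezout_or_prime_dvd`) there is `v ∈ ℤ^d` with
`ψ(v) = 1`, every `β_p = 1` and `∏_p β_p = 1` (`SingleForm.singularProduct_eq_one`). Put
`A = λ + 2 > 2` and take Maier's rows from the tree (`Maier.matrix_rows`, Page-type uniform prime
number theorem + Maier's matrix): for all large `N` and `h₁ = ⌊log^A N⌋` a window `(m, m + h₁]`,
`N < m ≤ 2N`, with `≥ h₁(1 + η₁/4)/log 3N` primes; and — at the ADAPTED scale `N' = ⌊7m/10⌋`,
`h₂ = ⌊log^A N'⌋` — a window `(m', m' + h₂]`, `N' < m' ≤ 2N'`, with `≤ h₂(1 − η₂/4)/log N'`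
primes (the adaptation keeps `m'/m ∈ (0.69, 1.4]`, so that both families of boxes below fit into
ONE range `[X, 2X]^d`; two rows of the same matrix may sit at `N + 1` and `2N`, which no `X`
accommodates). The walk `z_k = q𝟙 + (r + k)v` (`m + 1 = c₀q + r`) of
`SingleForm.exists_box_ge` turns the first window into a box of side `H = (log X)^λ` with
`≥ (⌊H⌋+1)^d (h₁(1+η₁/4)/log 3N − c₀H)/h₁` prime values, and `SingleForm.exists_box_le` turns the
second into a box with `≤ (⌊H⌋+1)^d (h₂(1−η₂/4)/log N' + c₀H)/h₂`; with
`X = min(q, q') − (c₀ + h₁ + h₂)∑|vⱼ|` all corners lie in `[X, 2X]^d`, `log X = log N + O(1)`,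
`c₀ H/hᵢ ≪ 1/log² X`, and the constants `δ⁺ = η₁/8`, `δ⁻ = η₂/8` come out
(`surplus_endgame`, `deficit_endgame`). [cite: PandeyWoo2024, Theorem 5, Theorem 1 and §2.4]
[cite: Maier1985, Theorem]
-/

noncomputable section

open Filter Finset Topology

namespace Literature.Barriers.Parity

open Literature.NumberTheory.Sieve Literature.Barriers.Parity.Maier

namespace SingleForm

variable {d : ℕ}

/-! ## The primitive case -/

/-- **The primitive case (Bézout direction available).** For a single form `ψ` with `cⱼ ≥ 0`,
`c ≠ 0` and `ψ(v) = 1` for some `v ∈ ℤ^d`, and `λ > 1`: the conclusion of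
`SmallScalePatternIrregularity` with `δ⁺ = η₁/8`, `δ⁻ = η₂/16`, where `η₁, η₂` are the
oscillation constants of Maier's matrix (`Maier.matrix_rows`) for `A = λ + 2` and
`k = 4⌈A⌉ + 2`, `4⌈A⌉ + 3`. See the module docstring for the argument.
[cite: PandeyWoo2024, Theorem 5 and §2.4] [cite: Maier1985, Theorem] -/
theorem irregularity_bezout (Ψ : Fin 1 → AffLinForm d) (h0 : (Ψ 0).const = 0)
    (hc : ∀ j, 0 ≤ (Ψ 0).coeff j) (hne : (Ψ 0).coeff ≠ 0) {v : Fin d → ℤ}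
    (hv : (Ψ 0).eval v = 1) {lam : ℝ} (hlam : 1 < lam) :
    ∃ δp δm : ℝ, 0 < δp ∧ 0 < δm ∧ ∀ X₀ : ℕ, ∃ X : ℕ, X₀ ≤ X ∧
      (∃ x : Fin d → ℕ, (∀ j, X ≤ x j ∧ x j ≤ 2 * X) ∧
        (1 + δp) * smallScaleMainTerm Ψ lam X ≤ primePatternCount Ψ x ((Real.log X) ^ lam)) ∧
      (∃ x : Fin d → ℕ, (∀ j, X ≤ x j ∧ x j ≤ 2 * X) ∧
        (primePatternCount Ψ x ((Real.log X) ^ lam) : ℝ) ≤ (1 - δm) * smallScaleMainTerm Ψ lam X) := by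
  classical
  set ψ := Ψ 0 with hψdef
  -- ### the singular product is `1`
  have hprim : ∀ p : ℕ, p.Prime → ∃ j, ¬ (p : ℤ) ∣ ψ.coeff j := by
    intro p hp
    by_contra hcon
    push Not at hcon
    have h1 : (p : ℤ) ∣ ψ.eval v := by
      rw [eval_eq_sum ψ h0]
      exact dvd_sum fun j _ => dvd_mul_of_dvd_left (hcon j) _
    rw [hv] at h1
    have := Int.eq_one_of_dvd_one (by positivity) h1
    exact hp.one_lt.ne' (by exact_mod_cast this)
  have hS : singularProduct Ψ = 1 := singularProduct_eq_one Ψ h0 hprim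
  have hMT : ∀ X : ℕ, smallScaleMainTerm Ψ lam X = (Real.log X ^ lam) ^ d / Real.log X := by
    intro X
    unfold smallScaleMainTerm
    rw [hS, mul_one, pow_one]
  -- ### constants
  set c₀ : ℤ := ∑ j, ψ.coeff j with hc₀def
  have hc1 : 1 ≤ c₀ := one_le_sum_coeff ψ hc hne
  have hc0 : 0 < c₀ := by omega
  have hc1R : (1 : ℝ) ≤ c₀ := by exact_mod_cast hc1
  have hc0R : (0 : ℝ) < c₀ := by linarith only [hc1R]
  set V : ℤ := ∑ j, |v j| with hVdef
  have hV0 : 0 ≤ V := sum_nonneg fun j _ => abs_nonneg _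
  have hV0R : (0 : ℝ) ≤ V := by exact_mod_cast hV0
  have hC₁0 : 0 ≤ Real.log (4 * c₀) := Real.log_nonneg (by linarith only [hc1R])
  have hC₂0 : 0 ≤ Real.log (12 * c₀) := Real.log_nonneg (by linarith only [hc1R])
  have hlog3 : 0 < Real.log 3 := Real.log_pos (by norm_num)
  have hlog2 : Real.log 2 < 1 := by linarith only [log_two_lt]
  -- ### Maier's rows
  set A : ℝ := lam + 2 with hAdef
  have hA2 : 2 < A := by rw [hAdef]; linarith only [hlam]
  have hA0 : 0 < A := by linarith only [hA2]
  have hlam1 : 0 ≤ lam + 1 := by linarith only [hlam]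
  have hlam0 : 0 < lam := by linarith only [hlam]
  set mA : ℕ := ⌈A⌉₊ with hmAdef
  have hmA : A ≤ mA := Nat.le_ceil A
  obtain ⟨η₁, hη₁0, hη₁1, hev₁⟩ := matrix_rows hA2 (k := 4 * mA + 2) (by push_cast; linarith only [hmA, hA0])
  obtain ⟨η₂, hη₂0, hη₂1, hev₂⟩ := matrix_rows hA2 (k := 4 * mA + 3) (by push_cast; linarith only [hmA, hA0])
  refine ⟨η₁ / 8, η₂ / 16, by positivity, by positivity, fun X₀ => ?_⟩
  obtain ⟨N₁, hN₁⟩ := eventually_atTop.1 hev₁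
  obtain ⟨N₂, hN₂⟩ := eventually_atTop.1 hev₂
  -- ### the conditions on `L = log N`
  have Q1 : ∀ᶠ L : ℝ in atTop, Real.log (4 * c₀) + Real.log 3 + 2 ≤ L := eventually_ge_atTop _
  have Q2 : ∀ᶠ L : ℝ in atTop,
      (30 * c₀ * V) * (L + 1) ^ A + 15 * c₀ * (c₀ * V + 1) ≤ Real.exp L :=
    eventually_mul_rpow_add_le_exp (by positivity) zero_le_one hA0
  have Q3 : ∀ᶠ L : ℝ in atTop, 20 * Real.log (12 * c₀) ≤ η₁ * (L - Real.log (4 * c₀)) :=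
    ((tendsto_atTop_add_const_right _ _ tendsto_id).const_mul_atTop hη₁0).eventually_ge_atTop _
  have Q4 : ∀ᶠ L : ℝ in atTop, 20 * c₀ * (L + Real.log 3) ^ (lam + 1) ≤
      η₁ * ((L - (Real.log (4 * c₀) + Real.log 3)) ^ A - 1) :=
    eventually_mul_rpow_le_rpow_sub (by positivity) hlog3.le (by positivity)
      (by rw [hAdef]; linarith only) hA0 hη₁0
  have Q5 : ∀ᶠ L : ℝ in atTop, 20 * Real.log 3 ≤ η₂ * (L - (Real.log (4 * c₀) + Real.log 3)) :=
    ((tendsto_atTop_add_const_right _ _ tendsto_id).const_mul_atTop hη₂0).eventually_ge_atTop _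
  have Q6 : ∀ᶠ L : ℝ in atTop, 20 * c₀ * (L + Real.log 3) ^ (lam + 1) ≤
      η₂ * ((L - (Real.log (4 * c₀) + Real.log 3)) ^ A - 1) :=
    eventually_mul_rpow_le_rpow_sub (by positivity) hlog3.le (by positivity)
      (by rw [hAdef]; linarith only) hA0 hη₂0
  have Q7 : ∀ᶠ L : ℝ in atTop, (1 + 1 / (L - Real.log (4 * c₀)) ^ lam) ^ d ≤ 1 + η₂ / 20 :=
    eventually_one_add_inv_rpow_pow_le hlam0 (by linarith only [hη₂0]) d
  obtain ⟨L₀, hL₀⟩ := eventually_atTop.1 (Q1.and (Q2.and (Q3.and (Q4.and (Q5.and (Q6.and Q7))))))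
  -- ### the scale `N`
  set N : ℕ := max (max N₁ (2 * N₂ + 2)) (max ⌈Real.exp L₀⌉₊ (4 * c₀.toNat * (X₀ + 2) + 6))
    with hNdef
  have hNN₁ : N₁ ≤ N := le_trans (le_max_left _ _) (le_max_left _ _)
  have hNN₂ : 2 * N₂ + 2 ≤ N := le_trans (le_max_right _ _) (le_max_left _ _)
  have hNexp : ⌈Real.exp L₀⌉₊ ≤ N := le_trans (le_max_left _ _) (le_max_right _ _)
  have hNX₀ : 4 * c₀.toNat * (X₀ + 2) + 6 ≤ N := le_trans (le_max_right _ _) (le_max_right _ _)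
  have hN6 : 6 ≤ N := by omega
  have hN0R : (0 : ℝ) < N := by exact_mod_cast (show 0 < N by omega)
  have hN6R : (6 : ℝ) ≤ N := by exact_mod_cast hN6
  have hLL₀ : L₀ ≤ Real.log N := by
    have h1 : Real.exp L₀ ≤ N := (Nat.le_ceil _).trans (by exact_mod_cast hNexp)
    have := Real.log_le_log (Real.exp_pos _) h1
    rwa [Real.log_exp] at this
  obtain ⟨q1, q2, q3, q4, q5, q6, q7⟩ := hL₀ (Real.log N) hLL₀
  have hexpL : Real.exp (Real.log N) = N := Real.exp_log hN0R
  have hL2 : 2 ≤ Real.log N := by linarith only [q1, hC₁0, hlog3]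
  have hL0 : 0 < Real.log N := by linarith only [hL2]
  -- ### the surplus row at scale `N`
  have hLA1 : 1 ≤ Real.log N ^ A := Real.one_le_rpow (by linarith only [hL2]) hA0.le
  set h₁ : ℕ := ⌊Real.log N ^ A⌋₊ with hh₁def
  have hh₁1 : 1 ≤ h₁ := Nat.le_floor (by simpa using hLA1)
  have hh₁le : (h₁ : ℝ) ≤ Real.log N ^ A := Nat.floor_le (by positivity)
  have hh₁ge : Real.log N ^ A - 1 ≤ h₁ := (Nat.sub_one_lt_floor _).le
  have hLA' : Real.log N ^ A ≤ (Real.log N + 1) ^ A :=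
    Real.rpow_le_rpow hL0.le (by linarith only) hA0.le
  have hh₁up : (h₁ : ℝ) ≤ (Real.log N + 1) ^ A + 1 := by linarith only [hh₁le, hLA']
  have hh₁pos : (0 : ℝ) < h₁ := by exact_mod_cast hh₁1
  obtain ⟨m, hNm, hm2N, hR₁⟩ := (hN₁ N hNN₁ h₁ hh₁1 hh₁up hh₁ge).1 ⟨2 * mA + 1, by ring⟩
  have hmR : (m : ℝ) ≤ 2 * N := by exact_mod_cast hm2N
  -- ### the deficit row at the adapted scale `N' = ⌊7m/10⌋`
  set N' : ℕ := 7 * m / 10 with hN'def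
  have hN'1 : 10 * N' ≤ 7 * m := by
    have : N' * 10 ≤ 7 * m := Nat.div_mul_le_self (7 * m) 10
    omega
  have hN'2 : 7 * m < 10 * N' + 10 := by
    have : 7 * m < N' * 10 + 10 := Nat.lt_div_mul_add (by norm_num)
    omega
  have hN'N₂ : N₂ ≤ N' := by omega
  have hN'3 : 3 ≤ N' := by omega
  have hN'R3 : (3 : ℝ) ≤ N' := by exact_mod_cast hN'3
  have hN'0R : (0 : ℝ) < N' := by linarith only [hN'R3]
  have hlog31 : (1 : ℝ) ≤ Real.log 3 := by
    rw [Real.le_log_iff_exp_le (by norm_num)]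
    linarith only [Real.exp_one_lt_d9]
  have hL'1 : 1 ≤ Real.log N' := hlog31.trans (Real.log_le_log (by norm_num) hN'R3)
  have hL'0 : 0 < Real.log N' := by linarith only [hL'1]
  have hL'L : Real.log N' ≤ Real.log N + 1 := by
    have h1 : (N' : ℝ) ≤ 2 * N := by
      have e1 : ((10 * N' : ℕ) : ℝ) ≤ ((7 * m : ℕ) : ℝ) := by exact_mod_cast hN'1
      push_cast at e1
      linarith only [e1, hmR]
    have := Real.log_le_log hN'0R h1
    rw [Real.log_mul two_ne_zero hN0R.ne'] at this
    linarith only [this, hlog2]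
  have hL'A1 : 1 ≤ Real.log N' ^ A := Real.one_le_rpow hL'1 hA0.le
  set h₂ : ℕ := ⌊Real.log N' ^ A⌋₊ with hh₂def
  have hh₂1 : 1 ≤ h₂ := Nat.le_floor (by simpa using hL'A1)
  have hh₂le : (h₂ : ℝ) ≤ Real.log N' ^ A := Nat.floor_le (by positivity)
  have hh₂ge : Real.log N' ^ A - 1 ≤ h₂ := (Nat.sub_one_lt_floor _).le
  have hL'A' : Real.log N' ^ A ≤ (Real.log N' + 1) ^ A :=
    Real.rpow_le_rpow hL'0.le (by linarith only) hA0.le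
  have hh₂up : (h₂ : ℝ) ≤ (Real.log N' + 1) ^ A + 1 := by linarith only [hh₂le, hL'A']
  have hh₂pos : (0 : ℝ) < h₂ := by exact_mod_cast hh₂1
  obtain ⟨m', hN'm', hm'2N', hR₂⟩ := (hN₂ N' hN'N₂ h₂ hh₂1 hh₂up hh₂ge).2 ⟨2 * mA + 1, by ring⟩
  -- ### the common range `[X, 2X]`
  set q₁ : ℤ := ((m : ℤ) + 1) / c₀ with hq₁def
  set q₂ : ℤ := ((m' : ℤ) + 1) / c₀ with hq₂def
  have hq₁ : c₀ * q₁ ≤ m + 1 ∧ (m : ℤ) + 1 < c₀ * (q₁ + 1) := by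
    have h1 : ((m : ℤ) + 1) % c₀ + c₀ * q₁ = (m : ℤ) + 1 := Int.emod_add_mul_ediv _ _
    have h2 : 0 ≤ ((m : ℤ) + 1) % c₀ := Int.emod_nonneg _ hc0.ne'
    have h3 : ((m : ℤ) + 1) % c₀ < c₀ := Int.emod_lt_of_pos _ hc0
    constructor
    · linarith only [h1, h2]
    · linarith only [h1, h3]
  have hq₂ : c₀ * q₂ ≤ m' + 1 ∧ (m' : ℤ) + 1 < c₀ * (q₂ + 1) := by
    have h1 : ((m' : ℤ) + 1) % c₀ + c₀ * q₂ = (m' : ℤ) + 1 := Int.emod_add_mul_ediv _ _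
    have h2 : 0 ≤ ((m' : ℤ) + 1) % c₀ := Int.emod_nonneg _ hc0.ne'
    have h3 : ((m' : ℤ) + 1) % c₀ < c₀ := Int.emod_lt_of_pos _ hc0
    constructor
    · linarith only [h1, h2]
    · linarith only [h1, h3]
  set E : ℤ := (c₀ + h₁ + h₂) * V with hEdef
  have hE0 : 0 ≤ E := by positivity
  have hh₁le' : (h₁ : ℝ) ≤ (Real.log N + 1) ^ A := hh₁le.trans hLA'
  have hh₂le' : (h₂ : ℝ) ≤ (Real.log N + 1) ^ A :=
    hh₂le.trans (Real.rpow_le_rpow hL'0.le hL'L hA0.le)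
  have hEreal : (E : ℝ) ≤ (c₀ + 2 * (Real.log N + 1) ^ A) * V := by
    rw [hEdef]
    push_cast
    exact mul_le_mul_of_nonneg_right (by linarith only [hh₁le', hh₂le']) hV0R
  have hG : 15 * c₀ * E + 15 * c₀ ≤ 2 * (N : ℤ) := by
    have h15 : (0 : ℝ) ≤ 15 * c₀ := by positivity
    have : (15 * c₀ * E + 15 * c₀ : ℝ) ≤ 2 * N :=
      calc (15 * c₀ * E + 15 * c₀ : ℝ) = 15 * c₀ * (E + 1) := by ring
        _ ≤ 15 * c₀ * ((c₀ + 2 * (Real.log N + 1) ^ A) * V + 1) :=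
            mul_le_mul_of_nonneg_left (by linarith only [hEreal]) h15
        _ = (30 * c₀ * V) * (Real.log N + 1) ^ A + 15 * c₀ * (c₀ * V + 1) := by ring
        _ ≤ Real.exp (Real.log N) := q2
        _ = N := hexpL
        _ ≤ 2 * N := by linarith only [hN0R]
    exact_mod_cast this
  obtain ⟨ho1, ho2, ho3, ho4, ho5, ho6⟩ := corner_geometry hc1
    (show (N : ℤ) < m by exact_mod_cast hNm) (show (m : ℤ) ≤ 2 * N by exact_mod_cast hm2N)
    (show 10 * (N' : ℤ) ≤ 7 * m by exact_mod_cast hN'1)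
    (show 7 * (m : ℤ) < 10 * N' + 10 by exact_mod_cast hN'2)
    (show (N' : ℤ) < m' by exact_mod_cast hN'm') (show (m' : ℤ) ≤ 2 * N' by exact_mod_cast hm'2N')
    hq₁.1 hq₁.2 hq₂.1 hq₂.2 hE0 hG
  set Xz : ℤ := min q₁ q₂ - E with hXzdef
  set X : ℕ := Xz.toNat with hXdef
  have hXXz : (X : ℤ) = Xz := Int.toNat_of_nonneg ho6
  have hXR : (X : ℝ) = (Xz : ℝ) := by exact_mod_cast hXXz
  have hX₀2 : (X₀ : ℤ) + 2 ≤ Xz := by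
    have h1 : ((4 * c₀.toNat * (X₀ + 2) + 6 : ℕ) : ℤ) ≤ N := by exact_mod_cast hNX₀
    have h2 : (c₀.toNat : ℤ) = c₀ := Int.toNat_of_nonneg hc0.le
    push_cast at h1
    rw [h2] at h1
    have h3 : 4 * c₀ * ((X₀ : ℤ) + 2) < 4 * c₀ * Xz := by linarith only [h1, ho3]
    exact (lt_of_mul_lt_mul_left h3 (by positivity)).le
  have hX₀X : X₀ ≤ X := by
    have : (X₀ : ℤ) ≤ X := by rw [hXXz]; linarith only [hX₀2]
    exact_mod_cast this
  have hX2R : (2 : ℝ) ≤ X := by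
    have : (2 : ℤ) ≤ X := by rw [hXXz]; linarith only [hX₀2]
    exact_mod_cast this
  have hX0R : (0 : ℝ) < X := by linarith only [hX2R]
  have ho3R : (N : ℝ) ≤ 4 * c₀ * X := by rw [hXR]; exact_mod_cast ho3
  have ho4R : (X : ℝ) ≤ 3 * N := by rw [hXR]; exact_mod_cast ho4
  have ho5R : (X : ℝ) ≤ 3 * N' := by rw [hXR]; exact_mod_cast ho5
  have hℓpos : 0 < Real.log X := Real.log_pos (by linarith only [hX2R])
  have hR1 : Real.log N - Real.log (4 * c₀) ≤ Real.log X := by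
    have := Real.log_le_log hN0R ho3R
    rw [Real.log_mul (by positivity) hX0R.ne'] at this
    linarith only [this]
  have hR2 : Real.log X ≤ Real.log N + Real.log 3 := by
    have := Real.log_le_log hX0R ho4R
    rw [Real.log_mul (by norm_num) hN0R.ne'] at this
    linarith only [this]
  have hR3 : Real.log (3 * N) ≤ Real.log X + Real.log (12 * c₀) := by
    have := Real.log_le_log (by positivity) (show (3 : ℝ) * N ≤ 12 * c₀ * X by linarith only [ho3R])
    rw [Real.log_mul (by positivity) hX0R.ne'] at this
    linarith only [this]
  have hR4 : Real.log X - Real.log 3 ≤ Real.log N' := by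
    have := Real.log_le_log hX0R ho5R
    rw [Real.log_mul (by norm_num) hN'0R.ne'] at this
    linarith only [this]
  -- ### the boxes
  set Hn : ℕ := ⌊Real.log X ^ lam⌋₊ with hHndef
  have hHpos : 0 < Real.log X ^ lam := Real.rpow_pos_of_pos hℓpos lam
  have hHnle : (Hn : ℝ) ≤ Real.log X ^ lam := Nat.floor_le hHpos.le
  have hHnge : Real.log X ^ lam ≤ (Hn : ℝ) + 1 := (Nat.lt_floor_add_one _).le
  have hHd1 : (Real.log X ^ lam) ^ d ≤ ((Hn : ℝ) + 1) ^ d := pow_le_pow_left₀ hHpos.le hHnge d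
  have hpoly : 20 * c₀ * (Real.log X ^ lam * Real.log X) ≤
      20 * c₀ * (Real.log N + Real.log 3) ^ (lam + 1) := by
    rw [← Real.rpow_add_one hℓpos.ne' lam]
    exact mul_le_mul_of_nonneg_left (Real.rpow_le_rpow hℓpos.le hR2 hlam1) (by positivity)
  have hbase0 : 0 ≤ Real.log N - (Real.log (4 * c₀) + Real.log 3) := by linarith only [q1]
  have hbaseA : (Real.log N - (Real.log (4 * c₀) + Real.log 3)) ^ A ≤ Real.log N ^ A :=
    Real.rpow_le_rpow hbase0 (by linarith only [hC₁0, hlog3]) hA0.le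
  have hbaseA' : (Real.log N - (Real.log (4 * c₀) + Real.log 3)) ^ A ≤ Real.log N' ^ A :=
    Real.rpow_le_rpow hbase0 (by linarith only [hR1, hR4]) hA0.le
  obtain ⟨z, hzloc, hzcnt⟩ := exists_box_ge ψ h0 hc hne hv m Hn hh₁1
  obtain ⟨z', hz'loc, hz'cnt⟩ := exists_box_le ψ h0 hc hne hv m' Hn hh₂1
  simp only [← hc₀def] at hzloc hzcnt hz'loc hz'cnt
  -- corners in `[X, 2X]`
  have hh₁0 : (0 : ℤ) ≤ h₁ := by positivity
  have hh₂0 : (0 : ℤ) ≤ h₂ := by positivity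
  have hEz : (c₀ + h₁) * V ≤ E :=
    mul_le_mul_of_nonneg_right (by linarith only [hh₂0]) hV0
  have hEz' : (c₀ + h₂) * V ≤ E :=
    mul_le_mul_of_nonneg_right (by linarith only [hh₁0]) hV0
  have hzX : ∀ j, Xz ≤ z j ∧ z j ≤ 2 * Xz := fun j => by
    have hab := abs_le.1 ((hzloc j).trans hEz)
    have hmin := min_le_left q₁ q₂
    constructor
    · rw [hXzdef]; linarith only [hab.1, hmin]
    · linarith only [hab.2, ho1]
  have hz'X : ∀ j, Xz ≤ z' j ∧ z' j ≤ 2 * Xz := fun j => by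
    have hab := abs_le.1 ((hz'loc j).trans hEz')
    have hmin := min_le_right q₁ q₂
    constructor
    · rw [hXzdef]; linarith only [hab.1, hmin]
    · linarith only [hab.2, ho2]
  have hz0 : ∀ j, 0 ≤ z j := fun j => ho6.trans (hzX j).1
  have hz'0 : ∀ j, 0 ≤ z' j := fun j => ho6.trans (hz'X j).1
  have hcornz : ∀ j, X ≤ (z j).toNat ∧ (z j).toNat ≤ 2 * X := fun j =>
    ⟨(Int.le_toNat (hz0 j)).2 (by rw [hXXz]; exact (hzX j).1),
      Int.toNat_le.2 (by push_cast; rw [hXXz]; exact (hzX j).2)⟩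
  have hcornz' : ∀ j, X ≤ (z' j).toNat ∧ (z' j).toNat ≤ 2 * X := fun j =>
    ⟨(Int.le_toNat (hz'0 j)).2 (by rw [hXXz]; exact (hz'X j).1),
      Int.toNat_le.2 (by push_cast; rw [hXXz]; exact (hz'X j).2)⟩
  refine ⟨X, hX₀X, ⟨fun j => (z j).toNat, hcornz, ?_⟩, ⟨fun j => (z' j).toNat, hcornz', ?_⟩⟩
  · -- ### surplus
    rw [primePatternCount_eq_card Ψ hz0 (Real.log X ^ lam), hMT X]
    refine surplus_endgame (c₀ := (c₀ : ℝ)) (H' := (Hn : ℝ)) hη₁0 hη₁1 hℓpos hh₁pos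
      (by positivity) hHd1 hC₂0
      (Real.log_pos (by linarith only [hN6R])) hR3 hR₁
      (q3.trans (mul_le_mul_of_nonneg_left hR1 hη₁0.le)) ?_ hzcnt
    calc 20 * ((c₀ : ℝ) * Hn) * Real.log X = 20 * c₀ * (Hn * Real.log X) := by ring
      _ ≤ 20 * c₀ * (Real.log X ^ lam * Real.log X) := by gcongr
      _ ≤ 20 * c₀ * (Real.log N + Real.log 3) ^ (lam + 1) := hpoly
      _ ≤ η₁ * ((Real.log N - (Real.log (4 * c₀) + Real.log 3)) ^ A - 1) := q4
      _ ≤ η₁ * (Real.log N ^ A - 1) :=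
          mul_le_mul_of_nonneg_left (by linarith only [hbaseA]) hη₁0.le
      _ ≤ η₁ * h₁ := mul_le_mul_of_nonneg_left hh₁ge hη₁0.le
  · -- ### deficit
    rw [primePatternCount_eq_card Ψ hz'0 (Real.log X ^ lam), hMT X]
    have hHdP : ((Hn : ℝ) + 1) ^ d ≤ (1 + η₂ / 20) * (Real.log X ^ lam) ^ d := by
      have h1 : (Hn : ℝ) + 1 ≤ (1 + 1 / Real.log X ^ lam) * Real.log X ^ lam := by
        rw [add_mul, one_mul, one_div, inv_mul_cancel₀ hHpos.ne']
        linarith only [hHnle]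
      have hb : 0 < Real.log N - Real.log (4 * c₀) := by linarith only [q1, hlog3]
      have h2' : 1 / Real.log X ^ lam ≤ 1 / (Real.log N - Real.log (4 * c₀)) ^ lam :=
        one_div_le_one_div_of_le (Real.rpow_pos_of_pos hb lam)
          (Real.rpow_le_rpow hb.le hR1 hlam0.le)
      have h2 : (1 + 1 / Real.log X ^ lam) ^ d ≤
          (1 + 1 / (Real.log N - Real.log (4 * c₀)) ^ lam) ^ d :=
        pow_le_pow_left₀ (by positivity) (by linarith only [h2']) d
      calc ((Hn : ℝ) + 1) ^ d ≤ ((1 + 1 / Real.log X ^ lam) * Real.log X ^ lam) ^ d :=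
            pow_le_pow_left₀ (by positivity) h1 d
        _ = (1 + 1 / Real.log X ^ lam) ^ d * (Real.log X ^ lam) ^ d := mul_pow _ _ _
        _ ≤ (1 + η₂ / 20) * (Real.log X ^ lam) ^ d :=
            mul_le_mul_of_nonneg_right (h2.trans q7) (by positivity)
    refine deficit_endgame (c₀ := (c₀ : ℝ)) (H := Real.log X ^ lam) hη₂0 hη₂1 hh₂pos
      (by positivity) hHdP hlog3.le
      (by linarith only [hR1, q1]) hR4 (Nat.cast_nonneg _) hR₂
      (q5.trans (mul_le_mul_of_nonneg_left (by linarith only [hR1]) hη₂0.le)) (by positivity) ?_ ?_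
    · calc 20 * ((c₀ : ℝ) * Real.log X ^ lam) * Real.log X
          = 20 * c₀ * (Real.log X ^ lam * Real.log X) := by ring
        _ ≤ 20 * c₀ * (Real.log N + Real.log 3) ^ (lam + 1) := hpoly
        _ ≤ η₂ * ((Real.log N - (Real.log (4 * c₀) + Real.log 3)) ^ A - 1) := q6
        _ ≤ η₂ * (Real.log N' ^ A - 1) :=
            mul_le_mul_of_nonneg_left (by linarith only [hbaseA']) hη₂0.le
        _ ≤ η₂ * h₂ := mul_le_mul_of_nonneg_left hh₂ge hη₂0.le
    · refine hz'cnt.trans (mul_le_mul_of_nonneg_left ?_ (by positivity))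
      exact add_le_add le_rfl (mul_le_mul_of_nonneg_left hHnle hc0R.le)

end SingleForm

open SingleForm

variable {d : ℕ}

/-! ## The theorems -/

/-- **Pandey–Woo, Theorem 5, for systems of ONE form — PROVED.** For every `d ≥ 1`, every
in-scope system `Ψ = (ψ)` of a single linear form on `ℤ^d` (non-negative coefficients, not all
zero) and every `λ > 1` there are `δ⁺, δ⁻ > 0` such that for arbitrarily large `X`, with
`H = (log X)^λ`, some box `∏ⱼ [xⱼ, xⱼ + H]` with corner in `[X, 2X]^d` contains at least
`(1 + δ⁺) H^d (log X)^{-1} ∏_p β_p` points `n` with `ψ(n)` prime, and another at most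
`(1 − δ⁻) H^d (log X)^{-1} ∏_p β_p` of them: the conclusion of `SmallScalePatternIrregularity`
for `t = 1`. [cite: PandeyWoo2024, Theorem 5 (case `t = 1`) and Theorem 1] [cite: Maier1985, Theorem] -/
theorem smallScalePatternIrregularity_fin_one (Ψ : Fin 1 → AffLinForm d) (hΨ : InScope Ψ)
    {lam : ℝ} (hlam : 1 < lam) :
    ∃ δp δm : ℝ, 0 < δp ∧ 0 < δm ∧ ∀ X₀ : ℕ, ∃ X : ℕ, X₀ ≤ X ∧
      (∃ x : Fin d → ℕ, (∀ j, X ≤ x j ∧ x j ≤ 2 * X) ∧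
        (1 + δp) * smallScaleMainTerm Ψ lam X ≤ primePatternCount Ψ x ((Real.log X) ^ lam)) ∧
      (∃ x : Fin d → ℕ, (∀ j, X ≤ x j ∧ x j ≤ 2 * X) ∧
        (primePatternCount Ψ x ((Real.log X) ^ lam) : ℝ) ≤ (1 - δm) * smallScaleMainTerm Ψ lam X) := by
  obtain ⟨-, hconst, hcoef, hnz⟩ := hΨ
  rcases bezout_or_prime_dvd (Ψ 0).coeff (hnz 0) with ⟨v, hv⟩ | ⟨p, hp, hall⟩
  · have hv1 : (Ψ 0).eval v = 1 := by rw [eval_eq_sum _ (hconst 0)]; exact hv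
    exact irregularity_bezout Ψ (hconst 0) (hcoef 0) (hnz 0) hv1 hlam
  · exact ⟨1, 1, one_pos, one_pos, fun X₀ =>
      irregularity_obstructed Ψ (hconst 0) (hcoef 0) (hnz 0) hp hall lam X₀⟩


/-- **The case `d = 1` of `SmallScalePatternIrregularity` — PROVED** (all `t ≥ 1`): in dimension
one an in-scope system (finite complexity, no zero form) consists of a single form `ψ(n) = a n`,
`a ≥ 1`; for `a = 1` this is Maier's theorem for every `λ > 1` (Pandey–Woo's Theorem 1) in the
box normalisation of Theorem 5, for `a ≥ 2` the singular product vanishes.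
[cite: PandeyWoo2024, Theorem 1 and Theorem 5 (case `d = 1`)] [cite: Maier1985, Theorem] -/
theorem smallScalePatternIrregularity_dim_one (t : ℕ) (_ht : 1 ≤ t)
    (Ψ : Fin t → AffLinForm 1) (hΨ : InScope Ψ) {lam : ℝ} (hlam : 1 < lam) :
    ∃ δp δm : ℝ, 0 < δp ∧ 0 < δm ∧ ∀ X₀ : ℕ, ∃ X : ℕ, X₀ ≤ X ∧
      (∃ x : Fin 1 → ℕ, (∀ j, X ≤ x j ∧ x j ≤ 2 * X) ∧
        (1 + δp) * smallScaleMainTerm Ψ lam X ≤ primePatternCount Ψ x ((Real.log X) ^ lam)) ∧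
      (∃ x : Fin 1 → ℕ, (∀ j, X ≤ x j ∧ x j ≤ 2 * X) ∧
        (primePatternCount Ψ x ((Real.log X) ^ lam) : ℝ) ≤ (1 - δm) * smallScaleMainTerm Ψ lam X) := by
  obtain ⟨hfc, -, -, hnz⟩ := id hΨ
  have ht1 : t = 1 := by
    by_contra h
    have h2 : 2 ≤ t := by omega
    let i : Fin t := ⟨0, by omega⟩
    let j : Fin t := ⟨1, by omega⟩
    have hij : i ≠ j := by simp [i, j, Fin.ext_iff]
    have key := hfc i j hij ((Ψ j).coeff 0) ((Ψ i).coeff 0) (by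
      funext k
      fin_cases k
      simp [mul_comm])
    apply hnz i
    funext k
    fin_cases k
    simpa using key.2
  subst ht1
  exact smallScalePatternIrregularity_fin_one Ψ hΨ hlam

/-- **Theorem 5 (case `t = 1`) refutes Cramér-type small-scale uniformity — PROVED**: for
every in-scope single form with `∏_p β_p > 0` (equivalently: primitive) and every `λ > 1`,
`SmallScaleUniformity Ψ λ` fails. [cite: PandeyWoo2024, Theorem 5 and §1 (p. 3)] -/
theorem not_smallScaleUniformity_fin_one {Ψ : Fin 1 → AffLinForm d} (hΨ : InScope Ψ)
    (hS : 0 < singularProduct Ψ) {lam : ℝ} (hlam : 1 < lam) : ¬ SmallScaleUniformity Ψ lam := by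
  intro hU
  obtain ⟨δp, δm, hδp, -, hX⟩ := smallScalePatternIrregularity_fin_one Ψ hΨ hlam
  obtain ⟨X₀, hX₀⟩ := hU (δp / 2) (half_pos hδp)
  obtain ⟨X, hXge, ⟨x, hx, hcount⟩, -⟩ := hX (max X₀ 2)
  have hXX₀ : X₀ ≤ X := le_trans (le_max_left _ _) hXge
  have hX2 : 2 ≤ X := le_trans (le_max_right _ _) hXge
  have hM := smallScaleMainTerm_pos (lam := lam) hS hX2
  have hup := hX₀ X hXX₀ x hx
  rw [abs_le] at hup
  nlinarith [hup.2]

end Literature.Barriers.Parity
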